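import Mathlib
import HarnessLib
import Literature.AlgebraicGeometry.Ramification.InertiaNormalSylow
import Summits.ResolutionOfSingularities.ResolutionOfSingularities.Theorems.WildQuotientsWildQuotientResolutionCurveStep
import Summits.ResolutionOfSingularities.ResolutionOfSingularities.Theorems.WildQuotientsWildQuotientResolutionPhaseZeroDimOne
import Summits.ResolutionOfSingularities.ResolutionOfSingularities.Theorems.WildQuotientsWildQuotientResolutionStubInertiaLe
import Summits.ResolutionOfSingularities.ResolutionOfSingularities.Theorems.WildQuotientsWildQuotientResolutionInertLoci
import Summits.ResolutionOfSingularities.ResolutionOfSingularities.Theorems.WildQuotientsWildQuotientResolutionInertLocusCentre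

/-!
# The TAME MOVE of Phase 0 in every dimension: blow up the inert locus of a tame normal subgroup
# (crux `WildQuotients.WildQuotientResolution`, stub `stub_phaseZeroHighDim`)

Crux stmt-ResolutionOfSingularities-15640 (`WildQuotientResolution`), registered stub `stub_phaseZeroHighDim`
(Phase 0 for `dim X′ ≥ 3`: a `G`-equivariant proper birational REGULAR model with p-closed inertia groups and a
`G`-stable affine cover). ✓`CurveStep.curveMove` is the threefold CURVE MOVE; ✓`PointMove.pointMove` the point move.
This file packages, for the crux data in ANY dimension, the move of the all-dimensional tame layer (hand 6:
✓`TameFixedLocus` p817669, ✓`TameCentreStable` p817910, ✓`InertLocusStalk` p819500, ✓`InertLocusCentre`):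

**Theorem** (`tameMove`). For the crux data (`X′` integral regular, finite over the separated finite-type `X₁/k`,
`char k = p`, faithful action `ρ` of the finite group `G` over `q`) and a normal subgroup `1 ≠ K ⊴ G` of order
prime to `p`, the blow-up `π : X♯ → X′` of the REDUCED INERT LOCUS `Z_K = {y | K ≤ I_y}` (= the fixed locus of `K`
with trivial residue action; closed, `G`-stable, a regular subscheme with stalks the tame fixed-locus ideals
`⨆_{k ∈ K} I_{τ k}`) with the lifted action `ρ♯` is proper, birational, `X♯` integral and REGULAR (Liu 8.1.19 (a)),
`π` is `G`-equivariant, `I_x ≤ I_{π x}` for every `x ∈ X♯`, and `X♯` carries a `G`-stable affine cover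
(✓`StableAffineCoverBlowup.stub_stableAffineCoverBlowup`). In words: blowing up the fixed locus of a tame normal
subgroup is a legitimate move of Phase 0 in every dimension, preserving all structural clauses of the stub.
What it does to the inertia groups over `Z_K` (the termination question) is not addressed here.

[OURS · crux stmt-ResolutionOfSingularities-15640 · helper toward `stub_phaseZeroHighDim` (the tame move of the
all-dimensional design; NOT a proof of the stub); counted 0; AI-level work, weaker than expert review.]

* `vanishingIdeal_inertLocus_ne_bot` — for `K ≠ 1` the centre is a non-zero ideal sheaf (the generic point has
  trivial inertia, ✓`PhaseZeroDimOne.inertiaSubgroup_genericPoint_eq_bot`);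
* `tameMove` — the theorem.
-/

-- single-problem summit: the doubled namespace component `ResolutionOfSingularities` is forced
set_option linter.dupNamespace false

noncomputable section

namespace Summit.ResolutionOfSingularities.ResolutionOfSingularities.Theorems.WildQuotientResolution.InertLocusStalk

open CategoryTheory AlgebraicGeometry TopologicalSpace IsLocalRing
open Literature.AlgebraicGeometry.Resolution Literature.AlgebraicGeometry.Ramification
open Summit.ResolutionOfSingularities.ResolutionOfSingularities.Theorems.WildQuotientResolution

/-- **The centre of the tame move is non-zero**: for an integral `X` with a faithful action over a separated
`r : X → Y` and a subgroup `K ≠ 1`, the reduced ideal sheaf of the inert locus `Z_K` is not `⊥` — otherwise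
`Z_K = X` would contain the generic point, whose inertia group is trivial. [folklore] -/
theorem vanishingIdeal_inertLocus_ne_bot {X Y : Scheme.{0}} [IsIntegral X] (r : X ⟶ Y) [IsSeparated r]
    {G : Type} [Group G] (σ : G →* Aut X) (hr : ∀ g : G, (σ g).hom ≫ r = r)
    (hσ : Function.Injective σ) (K : Subgroup G) (hK : K ≠ ⊥)
    (hZ : IsClosed {y : X | K ≤ inertiaSubgroup σ y}) :
    Scheme.IdealSheafData.vanishingIdeal ⟨{y : X | K ≤ inertiaSubgroup σ y}, hZ⟩ ≠ ⊥ := by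
  intro h
  have hsupp : ((Scheme.IdealSheafData.vanishingIdeal
      ⟨{y : X | K ≤ inertiaSubgroup σ y}, hZ⟩).support : Set X) = Set.univ := by
    rw [h, Scheme.IdealSheafData.support_bot]
    rfl
  rw [Scheme.IdealSheafData.coe_support_vanishingIdeal] at hsupp
  have hsupp' : ({y : X | K ≤ inertiaSubgroup σ y} : Set X) = Set.univ := hsupp
  have hη : K ≤ inertiaSubgroup σ (genericPoint X) := by
    have : genericPoint X ∈ ({y : X | K ≤ inertiaSubgroup σ y} : Set X) := by
      rw [hsupp']
      exact Set.mem_univ _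
    exact this
  rw [PhaseZeroDimOne.inertiaSubgroup_genericPoint_eq_bot r σ hr hσ, le_bot_iff] at hη
  exact hK hη

/-- **The tame move of Phase 0, any dimension** (crux stmt-ResolutionOfSingularities-15640, toward
`stub_phaseZeroHighDim`). For the crux data — `k` a field of characteristic `p`, `X₁/k` separated of finite type,
`X′` integral and regular, `q : X′ → X₁` finite, `ρ` a faithful action of the finite group `G` on `X′` over `q` —
and a normal subgroup `K ⊴ G`, `K ≠ 1`, of order prime to `p`: the blow-up `π : X♯ → X′` of the reduced inert
locus `Z_K = {y | K ≤ I_y}` with the lifted action `ρ♯` is proper and birational, `X♯` is integral and REGULAR,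
`π` is equivariant, `π` is a blowing up of `𝓘_{Z_K}`, inertia groups do not grow (`I_x ≤ I_{π x}`), and `X♯` has
a `G`-stable affine cover. [folklore] -/
theorem tameMove (p : ℕ) (hp : p.Prime) (k : Type) [Field k] [CharP k p]
    (X' X₁ : Scheme.{0}) (f : X₁ ⟶ Spec (.of k)) (q : X' ⟶ X₁) (G : Type) [Group G] [Finite G]
    (ρ : G →* Aut X') (hfaith : Function.Injective ρ)
    [IsSeparated f] [LocallyOfFiniteType f] [QuasiCompact f] [IsIntegral X']
    (hreg : Scheme.IsRegular X') [IsFinite q] (hρ : ∀ g : G, (ρ g).hom ≫ q = q)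
    (K : Subgroup G) [K.Normal] (hK : K ≠ ⊥) (hcop : (Nat.card K).Coprime p) :
    ∃ (Xs : Scheme.{0}) (π : Xs ⟶ X') (ρs : G →* Aut Xs), IsProper π ∧ IsBirational π ∧
      IsIntegral Xs ∧ Scheme.IsRegular Xs ∧ (∀ g : G, (ρs g).hom ≫ π = π ≫ (ρ g).hom) ∧
      IsBlowup π (Scheme.IdealSheafData.vanishingIdeal ⟨{y : X' | K ≤ inertiaSubgroup ρ y},
        PointMoveNoNpcCurves.isClosed_setOf_le_inertia q ρ hρ K⟩) ∧
      (∀ x : Xs, inertiaSubgroup ρs x ≤ inertiaSubgroup ρ (π.base x)) ∧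
      ∀ x : Xs, ∃ U : Xs.Opens, IsAffineOpen U ∧ x ∈ U ∧ ∀ g : G, (ρs g).hom ⁻¹ᵁ U = U := by
  haveI : Fact p.Prime := ⟨hp⟩
  -- `X′` is Noetherian and separated (finite over the separated finite-type `X₁/k`)
  haveI : IsLocallyNoetherian X' := LocallyOfFiniteType.isLocallyNoetherian (q ≫ f)
  haveI : X'.IsSeparated := Scheme.isSeparated_of_isSeparated_over (q ≫ f)
  have hZ : IsClosed {y : X' | K ≤ inertiaSubgroup ρ y} :=
    PointMoveNoNpcCurves.isClosed_setOf_le_inertia q ρ hρ K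
  set 𝒥 : X'.IdealSheafData :=
    Scheme.IdealSheafData.vanishingIdeal ⟨{y : X' | K ≤ inertiaSubgroup ρ y}, hZ⟩ with h𝒥def
  -- residue characteristics of `X′`
  have hcharX : ∀ z : X', CharP (ResidueField (X'.presheaf.stalk z)) p := fun z =>
    (((IsLocalRing.residue (X'.presheaf.stalk z)).comp ((X'.presheaf.germ ⊤ z trivial).hom.comp
      (((q ≫ f).appTop).hom.comp (Scheme.ΓSpecIso (.of k)).inv.hom))).charP_iff_charP p).mp
      inferInstance
  -- the centre: non-zero, `G`-stable, regular subscheme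
  have hJne : 𝒥 ≠ ⊥ := vanishingIdeal_inertLocus_ne_bot q ρ hρ hfaith K hK hZ
  have h𝒥 : ∀ g : G, 𝒥.comap (ρ g).hom = 𝒥 := comap_vanishingIdeal_inertLocus ρ K hZ
  have hC : Scheme.IsRegular 𝒥.subscheme :=
    isRegular_subscheme_vanishingIdeal_inertLocus_of_coprime ρ K p hZ (fun x _ => hreg x)
      (fun x _ => hcharX x) hcop
  -- the blow-up and the lifted action
  obtain ⟨Xs, π, hπ⟩ := exists_isBlowup X' 𝒥
  let ρs : G →* Aut Xs := hπ.liftAction ρ h𝒥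
  have hequiv : ∀ g : G, (ρs g).hom ≫ π = π ≫ (ρ g).hom := hπ.liftAction_hom_comp ρ h𝒥
  haveI hXs : IsIntegral Xs := hπ.isIntegral hJne
  haveI hπp : IsProper π := hπ.isProper
  have hbir : IsBirational π := hπ.isBirational' hJne
  -- regularity of `X♯`: Liu 8.1.19 (a)
  have hXsreg : Scheme.IsRegular Xs := hπ.isRegular_of_isRegular_subscheme hreg hC
  refine ⟨Xs, π, ρs, hπp, hbir, hXs, hXsreg, hequiv, hπ, fun x => ?_, fun x => ?_⟩
  · exact InertiaLe.stub_inertia_le ρs ρ π hequiv x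
  · exact StableAffineCoverBlowup.stub_stableAffineCoverBlowup q ρ hρ hπ ρs hequiv x

end Summit.ResolutionOfSingularities.ResolutionOfSingularities.Theorems.WildQuotientResolution.InertLocusStalk

end
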